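import Summits.FinalStateConjecture.FinalStateConjecture.Theorems.EIHFluxBalanceRecedingWellsEnergy
import Summits.FinalStateConjecture.FinalStateConjecture.Theorems.EIHFluxBalanceRecedingWellsPoincare
import Summits.FinalStateConjecture.FinalStateConjecture.Theorems.EIHFluxBalanceRecedingWellsMultiplier

/-!
# Route EIHFluxBalance — `RecedingWellsEnergyBound`: the receding-wells potential and the two key steps

Seventh helper file for the support item stmt-FinalStateConjecture-10168
(`Summit.FinalStateConjecture.FinalStateConjecture.Theses.EIHFluxBalance.RecedingWellsEnergyBound`).
Specialisation of the abstract estimates to the coefficient `W(t, x) = V(x − vt) + V(x + vt)` of the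
toy: support and derivative bookkeeping for a compactly supported `C¹` potential
(`potential_support`, `recedingWells_fderiv`), a `C¹` cut-off (`exists_cutoff`), and the two
item-specific steps of the energy bound —
* `cutoff_mass_le_energy`: at `t = 0` the cut-off mass `∫ χ U²` is bounded by the energy through
  the potential-anchored Poincaré inequality (this is where `V ≢ 0` is used);
* `dopplerWeight_kills`: for `t ≥ 2R/v` the Doppler weight `β` of `exists_dopplerWeight`
  satisfies `β_x W = 0` and `W_t + β W_x = 0` (β is the velocity `±v` of each well on its
  support, and the wells have left the interpolation zone `|x| ≤ vt − R`).
The assembly is in `EIHFluxBalanceRecedingWellsEnergyBound`.  Elementary [folklore].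
-/

namespace Summit.FinalStateConjecture.FinalStateConjecture.Theorems

open MeasureTheory Set Filter Topology intervalIntegral

noncomputable section

namespace MovingWells

open WaveEnergy

/-! ### The potential and the receding-wells coefficient `W(t, x) = V(x − vt) + V(x + vt)` -/

/-- A compactly supported `V` and its derivative vanish for `|y| ≥ R`, some `R > 0`, and `V ≠ 0`
only on `|y| < R`. -/
theorem potential_support {V : ℝ → ℝ} (hVc : HasCompactSupport V) :
    ∃ R : ℝ, 0 < R ∧ (∀ y, R ≤ |y| → V y = 0 ∧ deriv V y = 0) ∧ (∀ y, V y ≠ 0 → |y| < R) := by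
  obtain ⟨r, hr⟩ := hVc.isCompact.isBounded.subset_closedBall (0 : ℝ)
  have hout : ∀ y, max r 0 + 1 ≤ |y| → y ∉ tsupport V := by
    intro y hy hmem
    have := hr hmem
    rw [Metric.mem_closedBall, dist_zero_right, Real.norm_eq_abs] at this
    linarith [le_max_left r 0]
  refine ⟨max r 0 + 1, by positivity, fun y hy => ?_, fun y hy => ?_⟩
  · refine ⟨image_eq_zero_of_notMem_tsupport (hout y hy), ?_⟩
    by_contra hne
    exact hout y hy (support_deriv_subset (Function.mem_support.mpr hne))
  · by_contra hge
    push Not at hge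
    exact hout y hge (subset_tsupport V (Function.mem_support.mpr hy))

/-- `W(t, x) = V(x − vt) + V(x + vt)` is `C¹` with `W_t = −vV'(x − vt) + vV'(x + vt)` and
`W_x = V'(x − vt) + V'(x + vt)`. -/
theorem recedingWells_fderiv {V : ℝ → ℝ} (hV : ContDiff ℝ 1 V) (v : ℝ) {W : ℝ × ℝ → ℝ}
    (hW : ∀ z, W z = V (z.2 - v * z.1) + V (z.2 + v * z.1)) :
    ContDiff ℝ 1 W ∧ ∀ t x : ℝ,
      fderiv ℝ W (t, x) (1, 0) = -v * deriv V (x - v * t) + v * deriv V (x + v * t)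
        ∧ fderiv ℝ W (t, x) (0, 1) = deriv V (x - v * t) + deriv V (x + v * t) := by
  have hVd : Differentiable ℝ V := hV.differentiable (by norm_num)
  have hfun : W = fun z : ℝ × ℝ => V (z.2 - v * z.1) + V (z.2 + v * z.1) := funext hW
  have hWc : ContDiff ℝ 1 W := by
    rw [hfun]
    exact (hV.comp (contDiff_snd.sub (contDiff_const.mul contDiff_fst))).add
      (hV.comp (contDiff_snd.add (contDiff_const.mul contDiff_fst)))
  have hWd : Differentiable ℝ W := hWc.differentiable (by norm_num)
  refine ⟨hWc, fun t x => ⟨?_, ?_⟩⟩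
  · have hs : HasDerivAt (fun τ => W (τ, x))
        (deriv V (x - v * t) * (-v) + deriv V (x + v * t) * v) t := by
      have h1 : HasDerivAt (fun τ : ℝ => x - v * τ) (-v) t := by
        simpa using ((hasDerivAt_id t).const_mul v).const_sub x
      have h2 : HasDerivAt (fun τ : ℝ => x + v * τ) v t := by
        simpa using ((hasDerivAt_id t).const_mul v).const_add x
      have h := ((hVd _).hasDerivAt.comp t h1).add ((hVd _).hasDerivAt.comp t h2)
      have hfun' : (fun τ => W (τ, x)) = fun τ => V (x - v * τ) + V (x + v * τ) :=
        funext fun τ => hW (τ, x)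
      rw [hfun']
      exact h
    rw [(hasDerivAt_slice_fst hWd t x).unique hs]
    ring
  · have hs : HasDerivAt (fun y => W (t, y))
        (deriv V (x - v * t) * 1 + deriv V (x + v * t) * 1) x := by
      have h1 : HasDerivAt (fun y : ℝ => y - v * t) 1 x := by
        simpa using (hasDerivAt_id x).sub_const (v * t)
      have h2 : HasDerivAt (fun y : ℝ => y + v * t) 1 x := by
        simpa using (hasDerivAt_id x).add_const (v * t)
      have h := ((hVd _).hasDerivAt.comp x h1).add ((hVd _).hasDerivAt.comp x h2)
      have hfun' : (fun y => W (t, y)) = fun y => V (y - v * t) + V (y + v * t) :=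
        funext fun y => hW (t, y)
      rw [hfun']
      exact h
    rw [(hasDerivAt_slice_snd hWd t x).unique hs]
    ring

/-- A `C¹` cut-off `0 ≤ χ ≤ 1` with `χ = 1` on `|x| ≤ 3R` and `χ = 0` on `|x| ≥ 3R + 1`
(a `ContDiffBump`). -/
theorem exists_cutoff {R : ℝ} (hR : 0 < R) :
    ∃ χ : ℝ → ℝ, ContDiff ℝ 1 χ ∧ (∀ x, 0 ≤ χ x) ∧ (∀ x, χ x ≤ 1)
      ∧ (∀ x, |x| ≤ 3 * R → χ x = 1) ∧ (∀ x, 3 * R + 1 ≤ |x| → χ x = 0) := by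
  let χb : ContDiffBump (0 : ℝ) := ⟨3 * R, 3 * R + 1, by positivity, by linarith⟩
  refine ⟨fun x => χb x, χb.contDiff, fun x => χb.nonneg, fun x => χb.le_one, fun x hx => ?_,
    fun x hx => ?_⟩
  · exact χb.one_of_mem_closedBall (by simpa [Metric.mem_closedBall, Real.norm_eq_abs] using hx)
  · exact χb.zero_of_le_dist (by simpa [Real.dist_eq] using hx)

/-- **Step 1 of the energy bound: the cut-off mass at `t = 0` is controlled by the energy.**
With an anchor `V ≥ μ > 0` on `[x₀ − δ, x₀ + δ] ⊆ [−L', L']`, a cut-off `χ ≤ 1` vanishing for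
`|x| ≥ L'`, and data of `U` vanishing (with all first partials) for `|y| ≥ Lb ≥ L'`:
`∫ χ U(0,·)² ≤ 2L'((δμ)⁻¹/2 + 4L') ∫ e(0,·)` (potential-anchored Poincaré inequality). -/
theorem cutoff_mass_le_energy {V : ℝ → ℝ} (hV : ContDiff ℝ 1 V) (hV0 : ∀ x, 0 ≤ V x) (v : ℝ)
    {x₀ δ μ L' Lb : ℝ} (hδ : 0 < δ) (hμ : 0 < μ) (hanchor : ∀ y ∈ Icc (x₀ - δ) (x₀ + δ), μ ≤ V y)
    (hL'0 : 0 ≤ L') (hL'1 : -L' ≤ x₀ - δ) (hL'2 : x₀ + δ ≤ L') (hLb : L' ≤ Lb)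
    {χ : ℝ → ℝ} (hχc : Continuous χ) (hχ1 : ∀ x, χ x ≤ 1) (hχzero : ∀ x, L' ≤ |x| → χ x = 0)
    {U e : ℝ × ℝ → ℝ} (hU : ContDiff ℝ 2 U)
    (he : ∀ z, e z = (fderiv ℝ U z (1, 0)) ^ 2 + (fderiv ℝ U z (0, 1)) ^ 2
      + (V (z.2 - v * z.1) + V (z.2 + v * z.1)) * U z ^ 2)
    (hvan0 : ∀ y, Lb ≤ |y| → ∀ w, U (0, y) = 0 ∧ fderiv ℝ U (0, y) w = 0) :
    ∫ x, χ x * U (0, x) ^ 2 ≤ 2 * L' * ((δ * μ)⁻¹ * (1 / 2) + 4 * L') * ∫ x, e (0, x) := by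
  have hUd := differentiable_of_contDiff_two hU
  set f : ℝ → ℝ := fun x => U (0, x) with hf
  have hfd : Differentiable ℝ f := fun x => (hasDerivAt_slice_snd hUd 0 x).differentiableAt
  have hfderiv : ∀ x, deriv f x = fderiv ℝ U (0, x) (0, 1) := fun x =>
    (hasDerivAt_slice_snd hUd 0 x).deriv
  have hf'c : Continuous (deriv f) := by
    rw [show deriv f = fun x => fderiv ℝ U (0, x) (0, 1) from funext hfderiv]
    exact (continuous_fderiv_apply hU (0, 1)).comp (Continuous.prodMk_right 0)
  have hfc : Continuous f := hfd.continuous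
  have hP := integral_sq_le_poincare_anchored hfd hf'c hV.continuous hV0 hδ hμ hanchor hL'1 hL'2
  -- `∫ χ f² = ∫_{-L'}^{L'} χ f² ≤ ∫_{-L'}^{L'} f²`
  have hM : ∫ x, χ x * U (0, x) ^ 2 = ∫ x in (-L')..L', χ x * f x ^ 2 := by
    refine integral_eq_intervalIntegral_of_abs fun y hy => ?_
    rw [hχzero y hy, zero_mul]
  have hM1 : (∫ x in (-L')..L', χ x * f x ^ 2) ≤ ∫ x in (-L')..L', f x ^ 2 := by
    refine intervalIntegral.integral_mono_on (by linarith) ?_ ?_ fun x _ => ?_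
    · exact (hχc.mul (hfc.pow 2)).intervalIntegrable _ _
    · exact (hfc.pow 2).intervalIntegrable _ _
    · nlinarith [hχ1 x, sq_nonneg (f x)]
  -- comparison with the energy at `t = 0` on `[-Lb, Lb]`
  have hE0eq : ∫ x, e (0, x) = ∫ x in (-Lb)..Lb, e (0, x) := by
    refine integral_eq_intervalIntegral_of_abs fun y hy => ?_
    have h := hvan0 y hy
    rw [he, (h (1, 0)).2, (h (0, 1)).2, (h (1, 0)).1]
    ring
  have he0 : ∀ x, e (0, x) = (fderiv ℝ U (0, x) (1, 0)) ^ 2 + deriv f x ^ 2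
      + (V x + V x) * f x ^ 2 := by
    intro x
    rw [he, hfderiv]
    simp [hf]
  have hec : Continuous fun x => e (0, x) := by
    rw [show (fun x => e (0, x)) = _ from funext he0]
    exact ((((continuous_fderiv_apply hU (1, 0)).comp (Continuous.prodMk_right (0 : ℝ))).pow 2).add
      (hf'c.pow 2)).add ((hV.continuous.add hV.continuous).mul (hfc.pow 2))
  have hVf : (∫ x in (-L')..L', V x * f x ^ 2) ≤ (1 / 2) * ∫ x in (-Lb)..Lb, e (0, x) := by
    have h1 : (∫ x in (-L')..L', V x * f x ^ 2) ≤ ∫ x in (-Lb)..Lb, V x * f x ^ 2 :=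
      intervalIntegral.integral_mono_interval (by linarith) (by linarith) hLb
        (Filter.Eventually.of_forall fun x => mul_nonneg (hV0 x) (sq_nonneg _))
        ((hV.continuous.mul (hfc.pow 2)).intervalIntegrable _ _)
    have h2 : (∫ x in (-Lb)..Lb, V x * f x ^ 2) ≤ ∫ x in (-Lb)..Lb, (1 / 2) * e (0, x) := by
      refine intervalIntegral.integral_mono_on (by linarith) ?_ ?_ fun x _ => ?_
      · exact (hV.continuous.mul (hfc.pow 2)).intervalIntegrable _ _
      · exact (hec.const_mul _).intervalIntegrable _ _
      · rw [he0]
        nlinarith [sq_nonneg (fderiv ℝ U (0, x) (1, 0)), sq_nonneg (deriv f x),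
          mul_nonneg (hV0 x) (sq_nonneg (f x))]
    rw [intervalIntegral.integral_const_mul] at h2
    linarith
  have hDf : (∫ x in (-L')..L', deriv f x ^ 2) ≤ ∫ x in (-Lb)..Lb, e (0, x) := by
    have h1 : (∫ x in (-L')..L', deriv f x ^ 2) ≤ ∫ x in (-Lb)..Lb, deriv f x ^ 2 :=
      intervalIntegral.integral_mono_interval (by linarith) (by linarith) hLb
        (Filter.Eventually.of_forall fun x => sq_nonneg _)
        ((hf'c.pow 2).intervalIntegrable _ _)
    have h2 : (∫ x in (-Lb)..Lb, deriv f x ^ 2) ≤ ∫ x in (-Lb)..Lb, e (0, x) := by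
      refine intervalIntegral.integral_mono_on (by linarith) ?_ ?_ fun x _ => ?_
      · exact (hf'c.pow 2).intervalIntegrable _ _
      · exact hec.intervalIntegrable _ _
      · rw [he0]
        nlinarith [sq_nonneg (fderiv ℝ U (0, x) (1, 0)), mul_nonneg (hV0 x) (sq_nonneg (f x))]
    linarith
  rw [hM, hE0eq]
  have hE0' : 0 ≤ ∫ x in (-Lb)..Lb, e (0, x) :=
    intervalIntegral.integral_nonneg (by linarith) fun x _ => by
      rw [he0]
      nlinarith [sq_nonneg (fderiv ℝ U (0, x) (1, 0)), sq_nonneg (deriv f x),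
        mul_nonneg (hV0 x) (sq_nonneg (f x))]
  have hδμ : 0 ≤ (δ * μ)⁻¹ := by positivity
  calc (∫ x in (-L')..L', χ x * f x ^ 2) ≤ ∫ x in (-L')..L', f x ^ 2 := hM1
    _ ≤ 2 * L' * ((δ * μ)⁻¹ * (∫ y in (-L')..L', V y * f y ^ 2)
          + 4 * L' * ∫ y in (-L')..L', deriv f y ^ 2) := hP
    _ ≤ 2 * L' * ((δ * μ)⁻¹ * ((1 / 2) * ∫ x in (-Lb)..Lb, e (0, x))
          + 4 * L' * ∫ x in (-Lb)..Lb, e (0, x)) := by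
        gcongr
    _ = 2 * L' * ((δ * μ)⁻¹ * (1 / 2) + 4 * L') * ∫ x in (-Lb)..Lb, e (0, x) := by ring

/-- **Step 3 of the energy bound: the Doppler weight kills the source.** For `t ≥ T₁ = 2R/v`
(wells separated, `supp V, supp V' ⊆ (−R, R)`) the weight of `exists_dopplerWeight` satisfies
`β_x W = 0` and `W_t + β W_x = 0`. -/
theorem dopplerWeight_kills {V : ℝ → ℝ} {v R T₁ : ℝ} (hv : 0 < v) (hR : 0 < R)
    (hVR : ∀ y, R ≤ |y| → V y = 0 ∧ deriv V y = 0) {W : ℝ × ℝ → ℝ}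
    (hWz : ∀ z, W z = V (z.2 - v * z.1) + V (z.2 + v * z.1))
    (hWfd : ∀ t x : ℝ,
      fderiv ℝ W (t, x) (1, 0) = -v * deriv V (x - v * t) + v * deriv V (x + v * t)
        ∧ fderiv ℝ W (t, x) (0, 1) = deriv V (x - v * t) + deriv V (x + v * t))
    {β : ℝ × ℝ → ℝ} (hβ : ∀ t : ℝ, 2 * R / v ≤ t → ∀ x : ℝ,
      |β (t, x)| ≤ v
        ∧ |fderiv ℝ β (t, x) (1, 0)| ≤ fderiv ℝ β (t, x) (0, 1)
        ∧ (v * t - R < |x| → fderiv ℝ β (t, x) (0, 1) = 0)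
        ∧ (v * t - R < x → β (t, x) = v)
        ∧ (x < -(v * t - R) → β (t, x) = -v))
    (hT₁ : T₁ = 2 * R / v) {s : ℝ} (hs : T₁ ≤ s) (x : ℝ) :
    fderiv ℝ β (s, x) (0, 1) * W (s, x) = 0
      ∧ fderiv ℝ W (s, x) (1, 0) + β (s, x) * fderiv ℝ W (s, x) (0, 1) = 0 := by
  have hs' : 2 * R / v ≤ s := hT₁ ▸ hs
  have hvs : 2 * R ≤ v * s := by
    have := (div_le_iff₀ hv).mp hs'
    linarith
  obtain ⟨-, -, h3, h4, h5⟩ := hβ s hs' x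
  constructor
  · rcases lt_or_ge (v * s - R) |x| with hx | hx
    · rw [h3 hx, zero_mul]
    · have hxle := (le_abs_self x).trans hx
      have hxge := (neg_abs_le x).trans' (neg_le_neg hx)
      have h1 : R ≤ |x - v * s| := by
        rw [abs_of_nonpos (by linarith)]; linarith
      have h2 : R ≤ |x + v * s| := by
        rw [abs_of_nonneg (by linarith)]; linarith
      rw [hWz, (hVR _ h1).1, (hVR _ h2).1]
      ring
  · rw [(hWfd s x).1, (hWfd s x).2]
    rcases lt_trichotomy (v * s - R) x with hx | hx | hx
    · -- right of the gap: `β = v`, and `x + vs` is beyond the support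
      have h2 : R ≤ |x + v * s| := by
        rw [abs_of_nonneg (by linarith)]; linarith
      rw [h4 hx, (hVR _ h2).2]
      ring
    · -- boundary point: both `V'` vanish
      have h1 : R ≤ |x - v * s| := by
        rw [abs_of_nonpos (by linarith)]; linarith
      have h2 : R ≤ |x + v * s| := by
        rw [abs_of_nonneg (by linarith)]; linarith
      rw [(hVR _ h1).2, (hVR _ h2).2]
      ring
    · rcases lt_or_ge x (-(v * s - R)) with hx' | hx'
      · -- left of the gap: `β = -v`, and `x - vs` is beyond the support
        have h1 : R ≤ |x - v * s| := by
          rw [abs_of_nonpos (by linarith)]; linarith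
        rw [h5 hx', (hVR _ h1).2]
        ring
      · -- inside the gap: both `V'` vanish
        have h1 : R ≤ |x - v * s| := by
          rw [abs_of_nonpos (by linarith)]; linarith
        have h2 : R ≤ |x + v * s| := by
          rw [abs_of_nonneg (by linarith)]; linarith
        rw [(hVR _ h1).2, (hVR _ h2).2]
        ring

end MovingWells

end

end Summit.FinalStateConjecture.FinalStateConjecture.Theorems
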